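import Mathlib
import HarnessLib
import Literature.MathematicalPhysics.QuantumLattice.TorusLabelDistance
import Summits.HubbardSuperconductivity.HubbardSuperconductivity.Theorems.KLProgrammeKLRegimeSplitGenericV3

/-!
# Route `KLProgramme` — crux K3, ENGINE child (stmt-HubbardSuperconductivity-19918 and its gen-6 successor `KLRegimeEngineV15`):
# the engine-PRIVATE invariant **(E3-M) `TwoLegKernelMoments`** — L-uniform weighted first space-time moments of the UNSECTORISED,
# counterterm-separated two-leg kernel of the scale-`n` action at EVERY Matsubara label — and the corollary STATEMENT that turns it
# into the one-volume momentum modulus (M) of the VL child's carrier export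
# (cell gate-hubbard-kl, seat hubbard-kl-k3c5-p1 g6 «stub_asm_matsubara suppliers»; plan g14 (R15)(ii) CORRECTED + TASK, STATUS 2026-08-27T06:12:26Z;
# pattern = p5's `…KernelNormsLevelsDefs` (E1-F); `--supports` the ENGINE child as a helper)

WHY.  Every PUBLIC slot of the bundles `klPredsV14`/`klPredsV15` reads the two-leg kernel of the scale-`n` action only at the lowest
Matsubara pair `ω = ±ω₀` (`klLocSelfEnergyRe`, …SplitConsts; `fieldStrength`; `SelfEnergySymmetric`), and `KernelNormsV4` is `p ≥ 2`
(≥ 4 legs).  The VL child's carrier export (`…KLRegimeVolumeLimit.stub_vl_carrierRate`, «cauchy» v3/v4; k3c5-p3's nested split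
`carrierRateText_of_nested hN hM`, k3c5-p2's framed door `klRegimeVolumeLimitV14_of_framedCarrierRate`) asks the fully integrated kernel
`klSelfEnergy L M β U μ K klE0 (nScales β + 1) (ω, k) σ` at EVERY label `ω : MatsubaraIdx M`; so its one-volume MOMENTUM MODULUS (M)
— `‖Σ̂_{L,M}(ω,k₁) − Σ̂_{L,M}(ω,k₂)‖ ≤ ρ′ L + D·Σ_i |p_{k₁} i − p_{k₂} i|_𝕋` — is not slot algebra (seat census, STATUS 06:10:07Z; planner
06:12:26Z).  By the typing authority's ruling it is the slot-free corollary of an engine-PRIVATE invariant carried through the engine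
skeleton's own strong induction over `HistP` (the T3 door of the (R12) ruling, like (E1-F) `KernelNormsLevels`, p504160): the (E4)-analogue for
TWO legs.  This file TYPES that invariant and STATES the corollary (definitions with bodies + bookkeeping lemmas; no analytic claim):

* `klSepAction … K e₀ n := klEffectiveAction … K e₀ n − counterQuadratic L M β K` — the scale-`n` action with the counterterm vertex `𝒩_K`
  SEPARATED (p1b's `G'` of `…SplitTwoLegCounterVertex`: `Σ_{𝒩_K}((ω,k⃗),σ) = K(p_k⃗)` exactly, `selfEnergy_counterQuadratic`; the frame's own
  position kernel has range `4^{nScales β}` at every scale and cannot sit under a scale-`n` majorant — it re-enters the modulus through the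
  Lipschitz constant of the FIXED trigonometric polynomial `K`, which the VL text's `∃ D` (after `K`) absorbs);
* `klTwoLegPosKernel … n σ x y` — the UNSECTORISED (`trivialMultiplier`: all frequencies, all momenta) position-space kernel of the string
  `ψ⁺_{xσ} ψ⁻_{yσ}` of `klSepAction … n` on the `2M`-point imaginary-time grid `SpaceTimeIdx L M` (p1b's `W_σ` of `…SplitTwoLegMomentsFromPosition`,
  whose `card_sq_mul_kernel_two_eq_sum` inverts it to `selfEnergy`);
* `twoLegMomentWeight L M β x y := 1 + [(β/2M)·|x₀ − y₀|_{2M} + |x⃗ − y⃗|_{ℓ^∞,𝕋}]` — the weight `1 + (time coefficient)·cyclicDist + torusSiteDist`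
  of `EngineV8.firstMoment_zero_le_of_torusSums`'s `hT`, written with the Literature label pseudo-distance
  `Literature.MathematicalPhysics.QuantumLattice.spaceTimeDist (2M) (imagTimeWeight β M) 1` (an `IsLabelDist`, so the decay-weighted
  single-scale engine `GrassmannWeightedEffectiveActionBound` produces bounds in exactly this weight; the slot distance
  `KLRegimeSplit.spaceTimeDist` (max form) is dominated by it);
* `klTwoLegKernelMoment … n σ x := ε_x Σ_y twoLegMomentWeight x y · ‖klTwoLegPosKernel … n σ x y‖` — the PINNED weighted moment (zeroth +
  first space-time moment in one functional; `ε_x = imagTimeWeight β M`);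
* `twoLegMomentBar P Q U n := Q.CE · P.Klam · |U| · 4ⁿ` — the majorant (seat's choice, see «PROFILE» below);
* **`TwoLegKernelMoments L M G P Q β U μ K n : Prop := ∀ σ x, klTwoLegKernelMoment … K klE0 n σ x ≤ twoLegMomentBar P Q U n`** — (E3-M);
* the TEXTS (bundle-generic in `Pr : Preds`, `W : Set ℝ`, as k3c5-p3's doors): `TwoLegMomentsText Pr W` (the invariant at every scale
  `n ≤ nScales β + 1` beyond own thresholds, under the VL child's binder prefix and tower) and `FramedCarrierModulusText Pr W` (= the (M)
  half `hM` of `carrierRateText_of_nested` with the binders' frame `K` in place of `0` — the engine's own variables, k3c5-p2 06:00:57Z);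
* **`CarrierModulusOfTwoLegMoments Pr W : Prop := TwoLegMomentsText Pr W → FramedCarrierModulusText Pr W`** — the COROLLARY STATEMENT
  (proof = Fourier inversion `Σ̂ = 2ε_x·avg_x Σ_y W e^{iωΔt}χ_k(Δx⃗)` + `|χ_{k₁}(z⃗) − χ_{k₂}(z⃗)| ≤ |z⃗|_{ℓ^∞}·Σ_i|p₁ᵢ − p₂ᵢ|_𝕋`
  (k3c5-p3's `norm_torusFourier_sub_torusFourier_le_firstMoment` mechanism, p498107) + `K` Lipschitz; `D := 2·twoLegMomentBar … (nScales β+1) + Lip K`,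
  `ρ′ := 0`; filed separately as a proof).

PROFILE of the majorant (numbers, for the engine lineage's v2 registration — re-typable at zero consumer cost, the only readers being the
corollary above and the VL bound, which need finiteness only).  Zeroth part: the tadpole is local and `O(|U|)`, the cumulants of order
`≥ 2` are `O(U²)`; first part: a contribution whose lines live at scale `j ≤ n` has space-time range `Λ_j⁻¹ = 4ʲ/klE0` (BGM 2006 §3 (3.2):
`∫dx |x γ^{h}|ʲ |g^{(h)}(x)| ≤ C_j`), so the cumulative first moment is `≲ U²·Σ_{j≤n} 4ʲ ≲ U²·4ⁿ`; the counterterm-separated kernel keeps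
range `4ⁿ` because the frame's sub-scale structure `|Kp_{n'}| ≲ U 4^{−2n'} ≪ Λ_n` enters scale-`n` lines only perturbatively.  Hence
`Q.CE·Klam·|U|·4ⁿ` with `Q` sized after `R` (the order of `EngineP4`, as for `msBarQ` in (R12) T1b) — linear in `|U|` to host the tadpole,
`4ⁿ` for the first moment; at the last scale `4^{nScales β + 1} ≤ 4 klE0 β/π`, i.e. `D = O(|U| β)` (the thermal length).  This is an OUTPUT
invariant: no engine step reads it as an input size (two-leg insertions are controlled by the (E3) slot data), so generosity costs nothing.

Definitions with bodies; nothing about the model is asserted; nothing asserts superconductivity.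

References: G. Benfatto, A. Giuliani, V. Mastropietro, Ann. Henri Poincaré 7 (2006) 809–898 = arXiv:cond-mat/0507686, §2.1 (2.5), §2.3 (2.17),
§3 (3.2) [cite: BenfattoGiulianiMastropietro2006]; cell files HOME/STATUS.md 2026-08-27T06:10:07Z (slot census), 06:12:26Z ((R15)(ii) corrected).
-/

noncomputable section

namespace Summit.HubbardSuperconductivity.HubbardSuperconductivity.Theorems.KLRegimeSplit

set_option linter.dupNamespace false -- summit = problem name (single-conjunct summit), D-0017

open Real Finset Filter Topology Literature.MathematicalPhysics.QuantumLattice Literature.Probability.LatticeModels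
open Summit.HubbardSuperconductivity.HubbardSuperconductivity.Theorems.KLProgrammeLegKernels

/-! ## §1 The counterterm-separated action, its unsectorised two-leg position kernel, the weight and the pinned moment -/

section Model

variable (L M : ℕ) [NeZero L]

/-- **The space-time moment weight** `1 + (β/2M)·|x₀ − y₀|_{2M} + |x⃗ − y⃗|_{ℓ^∞,𝕋}` on the `2M`-point imaginary-time grid times the torus:
one plus the Literature label pseudo-distance `spaceTimeDist (2M) (imagTimeWeight β M) 1` (physical imaginary-time distance on the circle of
length `β` plus the periodic `ℓ^∞` lattice distance) — the shape of `EngineV8.firstMoment_zero_le_of_torusSums`'s `hT` weight. [folklore] -/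
def twoLegMomentWeight (β : ℝ) (x y : SpaceTimeIdx L M) : ℝ :=
  1 + Literature.MathematicalPhysics.QuantumLattice.spaceTimeDist (2 * M) (imagTimeWeight β M) 1 x y

/-- **The counterterm-separated scale-`n` action** `G'_n(K) := 𝒱^{(n)}(K) − 𝒩_K`: the KL effective action at scale index `n` in the frame
`K` minus the counterterm vertex (its two-leg kernel is the tadpole plus the cumulants of order `≥ 2`; the frame re-enters the self-energy as
the exact summand `K(p_k⃗)`, `selfEnergy_counterQuadratic`). [folklore] -/
def klSepAction (β U μ : ℝ) (K : TrigPolyC4v) (e₀ : ℝ) (n : ℕ) : HubbardGrassmann L M :=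
  klEffectiveAction L M β U μ K e₀ n - counterQuadratic L M β K

/-- **The unsectorised two-leg position kernel** `W^{(n)}_σ(x, y)` of the counterterm-separated scale-`n` action: the position-space kernel
of the string `ψ⁺_{xσ} ψ⁻_{yσ}` with the TRIVIAL multiplier (no sector or scale cutoff on the legs — all Matsubara frequencies, all momenta;
BGM 2006 (2.17) `W^{(h)}_2(x, y)`). [cite: BenfattoGiulianiMastropietro2006, §2.3 (2.17)] -/
def klTwoLegPosKernel (β U μ : ℝ) (K : TrigPolyC4v) (e₀ : ℝ) (n : ℕ) (σ : Fin 2) (x y : SpaceTimeIdx L M) : ℂ :=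
  sectorisedKernel L M β (trivialMultiplier L M) (klSepAction L M β U μ K e₀ n) 2
    (![((0, σ), 0), ((0, σ), 1)] : Fin 2 → SectorLeg 1) ![x, y]

/-- **The pinned weighted space-time moment** of the two-leg kernel at scale `n`, spin `σ`, pinned point `x`:
`ε_x · Σ_y (1 + |x − y|_{β,L}) · ‖W^{(n)}_σ(x, y)‖` (`ε_x = imagTimeWeight β M`; zeroth and first moment in one functional). [folklore] -/
def klTwoLegKernelMoment (β U μ : ℝ) (K : TrigPolyC4v) (e₀ : ℝ) (n : ℕ) (σ : Fin 2) (x : SpaceTimeIdx L M) : ℝ :=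
  imagTimeWeight β M * ∑ y : SpaceTimeIdx L M, twoLegMomentWeight L M β x y * ‖klTwoLegPosKernel L M β U μ K e₀ n σ x y‖

end Model

/-! ## §2 The majorant and the invariant (E3-M) -/

/-- **The majorant of (E3-M)**: `Q.CE · P.Klam · |U| · 4ⁿ` — linear in `|U|` (the tadpole sits in the zeroth moment), `4ⁿ = klE0/Λ_n · const`
for the first moment (space-time range of the scale-`≤ n` lines); `Q` is chosen after `R` in `EngineP4`, so the engine sizes `Q.CE` against
its own tree bounds. [folklore] -/
def twoLegMomentBar (P : SplitConsts) (Q : EngConsts) (U : ℝ) (n : ℕ) : ℝ :=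
  Q.CE * P.Klam * |U| * (4 : ℝ) ^ n

section Model

variable (L M : ℕ) [NeZero L]

/-- **(E3-M) `TwoLegKernelMoments L M G P Q β U μ K n`** — the engine-private invariant: at scale `n`, for every spin and every pinned
space-time point, the weighted first space-time moment of the unsectorised, counterterm-separated two-leg position kernel is at most
`twoLegMomentBar P Q U n`, uniformly in `L`, `M`, `μ`, `K` (`K` is read through the lattice only, inside `klEffectiveAction`/`counterQuadratic`;
`G` is carried for slot-shape uniformity with (E4) `EngineFirstMoments`). [folklore] -/
def TwoLegKernelMoments (_G : GeoConsts) (P : SplitConsts) (Q : EngConsts) (β U μ : ℝ) (K : TrigPolyC4v) (n : ℕ) : Prop :=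
  ∀ (σ : Fin 2) (x : SpaceTimeIdx L M), klTwoLegKernelMoment L M β U μ K klE0 n σ x ≤ twoLegMomentBar P Q U n

end Model

/-! ## §3 The texts: the invariant along the tower, the framed modulus (M), and the corollary statement -/

/-- **`TwoLegMomentsText Pr W`** — (E3-M) at every scale `n ≤ nScales β + 1` beyond own volume / cutoff thresholds, under the VL child's binder
prefix (`Pr.frameOK`, regime, tower of the SAME frame `K`): what the VL prover obtains by running the engine skeleton's strong induction over
`HistP` (available from `TowerP`) with the landed engine stubs. [folklore] -/
def TwoLegMomentsText (Pr : Preds) (W : Set ℝ) : Prop :=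
  ∀ (G : GeoConsts) (P : SplitConsts) (Q : EngConsts) (R : RenConsts), G.WF → P.WF → Q.WF → R.WF →
    ∃ c₅ : ℝ, 0 < c₅ ∧ ∀ c : ℝ, 0 < c → c ≤ c₅ → ∃ U₀ : ℝ, 0 < U₀ ∧
      ∀ μ ∈ W, ∀ U : ℝ, 0 < U → U ≤ U₀ → ∀ β : ℝ, klBetaMin ≤ β → β ≤ Real.exp (c / U ^ 2) →
        ∀ K : TrigPolyC4v, Pr.frameOK R U (nScales β) μ K →
          ∀ (Lstar : ℕ) (Mstar : ℕ → ℕ), TowerP Pr G P Q R β U μ K Lstar Mstar →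
            ∃ L₁ : ℕ, ∃ M₁ : ℕ → ℕ, ∀ (L : ℕ) [NeZero L], L₁ ≤ L → ∀ (M : ℕ) [NeZero M], M₁ L ≤ M →
              ∀ n ≤ nScales β + 1, TwoLegKernelMoments L M G P Q β U μ K n

/-- **`FramedCarrierModulusText Pr W`** — the one-volume MOMENTUM MODULUS (M) of the last-scale two-leg kernel IN THE FRAME `K` of the binders
(the (M) hypothesis `hM` of k3c5-p3's `carrierRateText_of_nested` with `K` for `0`; spin `0`): beyond a volume threshold there are `D` and
`ρ′ → 0` with, eventually in the cutoff, `‖Σ̂^K_{L,M}((ω,k₁),0) − Σ̂^K_{L,M}((ω,k₂),0)‖ ≤ ρ′ L + D·Σ_i |p_{k₁} i − p_{k₂} i|_𝕋` for every label `ω`. [folklore] -/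
def FramedCarrierModulusText (Pr : Preds) (W : Set ℝ) : Prop :=
  ∀ (G : GeoConsts) (P : SplitConsts) (Q : EngConsts) (R : RenConsts), G.WF → P.WF → Q.WF → R.WF →
    ∃ c₅ : ℝ, 0 < c₅ ∧ ∀ c : ℝ, 0 < c → c ≤ c₅ → ∃ U₀ : ℝ, 0 < U₀ ∧
      ∀ μ ∈ W, ∀ U : ℝ, 0 < U → U ≤ U₀ → ∀ β : ℝ, klBetaMin ≤ β → β ≤ Real.exp (c / U ^ 2) →
        ∀ K : TrigPolyC4v, Pr.frameOK R U (nScales β) μ K →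
          ∀ (Lstar : ℕ) (Mstar : ℕ → ℕ), TowerP Pr G P Q R β U μ K Lstar Mstar →
            ∃ L₀ : ℕ, ∃ D : ℝ, ∃ ρ' : ℕ → ℝ, Tendsto ρ' atTop (𝓝 0) ∧
              ∀ (L : ℕ) [NeZero L], L₀ ≤ L → ∃ M₀ : ℕ, ∀ (M : ℕ) [NeZero M], M₀ ≤ M →
                ∀ (ω : MatsubaraIdx M) (k₁ k₂ : TorusSite 2 L),
                  ‖klSelfEnergy L M β U μ K klE0 (nScales β + 1) (ω, k₁) 0 -
                      klSelfEnergy L M β U μ K klE0 (nScales β + 1) (ω, k₂) 0‖ ≤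
                    ρ' L + D * ∑ i, torusAbs (latticeMomentum L k₁ i - latticeMomentum L k₂ i)

/-- **THE COROLLARY STATEMENT `CarrierModulusOfTwoLegMoments Pr W`** := `TwoLegMomentsText Pr W → FramedCarrierModulusText Pr W` — (E3-M)
along the tower gives the framed modulus (M) of the VL carrier export (with `D := 2·twoLegMomentBar P Q U (nScales β + 1) + Lip K`,
`ρ′ := 0`).  Stated here as a `Prop`; its proof (Fourier inversion of the two-leg coefficient, the character-difference bound by the first
site moment, the Lipschitz constant of the fixed frame) is filed separately. [folklore] -/
def CarrierModulusOfTwoLegMoments (Pr : Preds) (W : Set ℝ) : Prop :=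
  TwoLegMomentsText Pr W → FramedCarrierModulusText Pr W

/-! ## §4 Bookkeeping -/

section Bookkeeping

variable {L M : ℕ} [NeZero L]

/-- The weight is at least one (`β ≥ 0`, `M ≠ 0`). [folklore] -/
theorem one_le_twoLegMomentWeight [NeZero M] {β : ℝ} (hβ : 0 ≤ β) (x y : SpaceTimeIdx L M) : 1 ≤ twoLegMomentWeight L M β x y := by
  rw [twoLegMomentWeight, le_add_iff_nonneg_right]
  exact (isLabelDist_spaceTimeDist (d := 2) (L := L) (2 * M) (imagTimeWeight_nonneg hβ M) zero_le_one).nonneg x y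

/-- The weight is nonnegative (`β ≥ 0`, `M ≠ 0`). [folklore] -/
theorem twoLegMomentWeight_nonneg [NeZero M] {β : ℝ} (hβ : 0 ≤ β) (x y : SpaceTimeIdx L M) : 0 ≤ twoLegMomentWeight L M β x y :=
  zero_le_one.trans (one_le_twoLegMomentWeight hβ x y)

omit [NeZero L] in
/-- **The weight dominates the periodic `ℓ^∞` lattice distance** of the two sites (what the momentum modulus reads). [folklore] -/
theorem torusSiteDist_le_twoLegMomentWeight [NeZero M] {β : ℝ} (hβ : 0 ≤ β) (x y : SpaceTimeIdx L M) :
    torusSiteDist x.2 y.2 ≤ twoLegMomentWeight L M β x y := by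
  rw [twoLegMomentWeight, Literature.MathematicalPhysics.QuantumLattice.spaceTimeDist, one_mul]
  have h0 : 0 ≤ imagTimeWeight β M * finCyclicDist (2 * M) x.1 y.1 :=
    mul_nonneg (imagTimeWeight_nonneg hβ M) ((isLabelDist_finCyclicDist (2 * M)).nonneg x.1 y.1)
  linarith

/-- **The weight dominates the physical imaginary-time distance** `(β/2M)·|x₀ − y₀|_{2M}` (a frequency modulus would read this). [folklore] -/
theorem time_le_twoLegMomentWeight [NeZero M] {β : ℝ} (x y : SpaceTimeIdx L M) :
    imagTimeWeight β M * finCyclicDist (2 * M) x.1 y.1 ≤ twoLegMomentWeight L M β x y := by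
  rw [twoLegMomentWeight, Literature.MathematicalPhysics.QuantumLattice.spaceTimeDist, one_mul]
  have h0 : 0 ≤ torusSiteDist x.2 y.2 := (isLabelDist_torusSiteDist (d := 2) (L := L)).nonneg x.2 y.2
  linarith

/-- The pinned moment is nonnegative (`β ≥ 0`, `M ≠ 0`). [folklore] -/
theorem klTwoLegKernelMoment_nonneg [NeZero M] {β : ℝ} (hβ : 0 ≤ β) (U μ : ℝ) (K : TrigPolyC4v) (e₀ : ℝ) (n : ℕ) (σ : Fin 2)
    (x : SpaceTimeIdx L M) : 0 ≤ klTwoLegKernelMoment L M β U μ K e₀ n σ x :=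
  mul_nonneg (imagTimeWeight_nonneg hβ M) (sum_nonneg fun y _ => mul_nonneg (twoLegMomentWeight_nonneg hβ x y) (norm_nonneg _))

/-- **The zeroth moment (pinned `L¹` size) is below the weighted moment** (weight `≥ 1`). [folklore] -/
theorem zerothMoment_le_klTwoLegKernelMoment [NeZero M] {β : ℝ} (hβ : 0 ≤ β) (U μ : ℝ) (K : TrigPolyC4v) (e₀ : ℝ) (n : ℕ) (σ : Fin 2)
    (x : SpaceTimeIdx L M) :
    imagTimeWeight β M * ∑ y : SpaceTimeIdx L M, ‖klTwoLegPosKernel L M β U μ K e₀ n σ x y‖ ≤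
      klTwoLegKernelMoment L M β U μ K e₀ n σ x := by
  unfold klTwoLegKernelMoment
  refine mul_le_mul_of_nonneg_left (sum_le_sum fun y _ => ?_) (imagTimeWeight_nonneg hβ M)
  exact le_mul_of_one_le_left (norm_nonneg _) (one_le_twoLegMomentWeight hβ x y)

/-- **The first SITE moment is below the weighted moment** (weight `≥` lattice distance). [folklore] -/
theorem siteMoment_le_klTwoLegKernelMoment [NeZero M] {β : ℝ} (hβ : 0 ≤ β) (U μ : ℝ) (K : TrigPolyC4v) (e₀ : ℝ) (n : ℕ) (σ : Fin 2)
    (x : SpaceTimeIdx L M) :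
    imagTimeWeight β M * ∑ y : SpaceTimeIdx L M, torusSiteDist x.2 y.2 * ‖klTwoLegPosKernel L M β U μ K e₀ n σ x y‖ ≤
      klTwoLegKernelMoment L M β U μ K e₀ n σ x := by
  unfold klTwoLegKernelMoment
  refine mul_le_mul_of_nonneg_left (sum_le_sum fun y _ => ?_) (imagTimeWeight_nonneg hβ M)
  exact mul_le_mul_of_nonneg_right (torusSiteDist_le_twoLegMomentWeight hβ x y) (norm_nonneg _)

/-- The majorant is nonnegative when the constants are (`CE, Klam ≥ 0`). [folklore] -/
theorem twoLegMomentBar_nonneg {P : SplitConsts} {Q : EngConsts} (hCE : 0 ≤ Q.CE) (hK : 0 ≤ P.Klam) (U : ℝ) (n : ℕ) :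
    0 ≤ twoLegMomentBar P Q U n := by
  unfold twoLegMomentBar; positivity

/-- The majorant is monotone in the scale index (`CE, Klam ≥ 0`). [folklore] -/
theorem twoLegMomentBar_mono {P : SplitConsts} {Q : EngConsts} (hCE : 0 ≤ Q.CE) (hK : 0 ≤ P.Klam) (U : ℝ) {n m : ℕ} (h : n ≤ m) :
    twoLegMomentBar P Q U n ≤ twoLegMomentBar P Q U m := by
  unfold twoLegMomentBar
  exact mul_le_mul_of_nonneg_left (pow_le_pow_right₀ (by norm_num) h) (by positivity)

/-- **The self-energy splits along the separation**: `Σ_{𝒱^{(n)}(K)} = Σ_{G'_n(K)} + Σ_{𝒩_K}` (linearity of `selfEnergy`). [folklore] -/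
theorem klSelfEnergy_eq_sep_add_counter (β U μ : ℝ) (K : TrigPolyC4v) (e₀ : ℝ) (n : ℕ) (k : FreqMomentum L M) (σ : Fin 2) :
    klSelfEnergy L M β U μ K e₀ n k σ =
      selfEnergy L M β (klSepAction L M β U μ K e₀ n) k σ + selfEnergy L M β (counterQuadratic L M β K) k σ := by
  have hk : ∀ (F G : HubbardGrassmann L M) (X : Fin 2 → HubbardFieldIdx L M),
      kernel ℂ (F - G) 2 X = kernel ℂ F 2 X - kernel ℂ G 2 X := fun F G X => by
    rw [sub_eq_add_neg, kernel_add, ← neg_one_smul ℂ G, kernel_smul]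
    ring
  simp only [klSelfEnergy, klSepAction, selfEnergy, vertexFn_def, hk, mul_sub]
  ring

/-- (E3-M) at a scale gives the unweighted pinned `L¹` size of the two-leg kernel there (`β ≥ 0`). [folklore] -/
theorem TwoLegKernelMoments.zeroth [NeZero M] {G : GeoConsts} {P : SplitConsts} {Q : EngConsts} {β U μ : ℝ} {K : TrigPolyC4v} {n : ℕ}
    (h : TwoLegKernelMoments L M G P Q β U μ K n) (hβ : 0 ≤ β) (σ : Fin 2) (x : SpaceTimeIdx L M) :
    imagTimeWeight β M * ∑ y : SpaceTimeIdx L M, ‖klTwoLegPosKernel L M β U μ K klE0 n σ x y‖ ≤ twoLegMomentBar P Q U n :=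
  (zerothMoment_le_klTwoLegKernelMoment hβ U μ K klE0 n σ x).trans (h σ x)

/-- (E3-M) at a scale gives the first site moment of the two-leg kernel there (`β ≥ 0`). [folklore] -/
theorem TwoLegKernelMoments.site [NeZero M] {G : GeoConsts} {P : SplitConsts} {Q : EngConsts} {β U μ : ℝ} {K : TrigPolyC4v} {n : ℕ}
    (h : TwoLegKernelMoments L M G P Q β U μ K n) (hβ : 0 ≤ β) (σ : Fin 2) (x : SpaceTimeIdx L M) :
    imagTimeWeight β M * ∑ y : SpaceTimeIdx L M, torusSiteDist x.2 y.2 * ‖klTwoLegPosKernel L M β U μ K klE0 n σ x y‖ ≤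
      twoLegMomentBar P Q U n :=
  (siteMoment_le_klTwoLegKernelMoment hβ U μ K klE0 n σ x).trans (h σ x)

end Bookkeeping

end Summit.HubbardSuperconductivity.HubbardSuperconductivity.Theorems.KLRegimeSplit

end
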